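import Literature.AlgebraicGeometry.Modules.TensorQuasicoherent
import HarnessLib

/-!
# Coproducts (direct sums) of quasi-coherent `𝒪_X`-modules are quasi-coherent (Stacks 01LA (1))

Layer `Literature/AlgebraicGeometry/Modules` (0 definitions, 0 named facts, no instances, no notation). The Stacks Project,
Tag 01LA (Schemes, Lemma "Let `X` be a scheme. (1) Any direct sum of quasi-coherent sheaves is quasi-coherent. …");
Hartshorne II Prop. 5.7 context; Görtz–Wedhorn I Cor. 7.19 (3). The affine case is the tree's
`Modules/TensorQuasicoherent.isQuasicoherent_sigmaObj_Spec` (`⨁ Nᵢ ≅ (⨁ Γ(Nᵢ))~` on `Spec R`); here it is globalised: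
restriction to an affine open is a left adjoint (Mathlib `Scheme.Modules.restrictAdjunction`), so it commutes with
coproducts, and quasi-coherence is local (Mathlib `IsQuasicoherent.of_coversTop`, through the tree's
`Modules/PullbackQuasicoherent.isQuasicoherent_over_of_presentation_restrict_fromSpec`).

* `nonempty_restrict_sigmaObj_iso` — `(∐ Nᵢ)|_U ≅ ∐ (Nᵢ|_U)` for an open immersion;
* **`isQuasicoherent_sigmaObj`** — `∐ Nᵢ` is quasi-coherent for quasi-coherent `Nᵢ` (any index type in the universe of `X`);
* **`IsAffineLocalizing.sigmaObj`** — the same for the tree's predicate (EGA I 1.4.1 / Hartshorne II Lemma 5.3), removing the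
  finite-support hypothesis of `Modules/AffineLocalizingBiproduct.IsAffineLocalizing.sigmaObj_of_finite_support`.

Everything is proved; no named fact. Library only (cell `pub-hodge-ring2`, count-neutral; proves nothing about any crux,
route or conjecture).

## References

* The Stacks Project, Tag 01LA (1) (direct sums of quasi-coherent modules), Tag 01I8. [StacksProject]
* R. Hartshorne, *Algebraic Geometry*, GTM 52 (1977), II Prop. 5.2, II Cor. 5.5, II Prop. 5.7. [Hartshorne1977]
* U. Görtz, T. Wedhorn, *Algebraic Geometry I*, 2nd ed. (2020), Cor. 7.19 (3). [GortzWedhorn2020]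
-/

noncomputable section

-- `TopCat.Presheaf`/`Scheme.Modules` are not reducible (as in Mathlib's `AlgebraicGeometry/Modules/Sheaf.lean`).
set_option backward.isDefEq.respectTransparency false

open CategoryTheory CategoryTheory.Limits AlgebraicGeometry TopologicalSpace Opposite
open SheafOfModules

universe u

namespace Literature.AlgebraicGeometry.Modules

variable {X : Scheme.{u}} {I : Type u} (N : I → X.Modules)

/-- **Restriction to an open commutes with coproducts**: `(∐ Nᵢ)|_U ≅ ∐ (Nᵢ|_U)` for an open immersion `f : U ⟶ X`
(`restrictFunctor f` is a left adjoint, Mathlib `Scheme.Modules.restrictAdjunction`). [cite: StacksProject, Tag 01LA] -/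
theorem nonempty_restrict_sigmaObj_iso {U : Scheme.{u}} (f : U ⟶ X) [IsOpenImmersion f] :
    Nonempty ((∐ N).restrict f ≅ ∐ fun i => (N i).restrict f) :=
  ⟨PreservesCoproduct.iso (Scheme.Modules.restrictFunctor f) N⟩

/-- The affine opens of a scheme cover it (`CoversTop` for the Zariski topology on `X.Opens`; private copy of the
private lemma of `Modules/QuasicoherentAbelian`). [folklore] -/
private theorem coversTop_affineOpens'' (X : Scheme.{u}) :
    (Opens.grothendieckTopology X).CoversTop (fun V : X.affineOpens => (V : X.Opens)) :=
  (Opens.coversTop_iff _ _).mpr (TopologicalSpace.IsOpenCover.mk (iSup_affineOpens_eq_top X))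

/-- **A coproduct (direct sum) of quasi-coherent `𝒪_X`-modules is quasi-coherent** (Stacks 01LA (1)), for any family
indexed in the universe of `X`: on each affine open `V`, `(∐ Nᵢ)|_{Spec Γ(X,V)} ≅ ∐ Nᵢ|` is quasi-coherent by the affine case
(`isQuasicoherent_sigmaObj_Spec`), hence `≅ Γ(…)~` has a global presentation; quasi-coherence is local.
[cite: StacksProject, Tag 01LA] [cite: GortzWedhorn2020, Cor. 7.19 (3)] [cite: Hartshorne1977, II Prop. 5.2 and Cor. 5.5] -/
theorem isQuasicoherent_sigmaObj [∀ i, (N i).IsQuasicoherent] : (∐ N).IsQuasicoherent := by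
  haveI : ∀ V : X.affineOpens, ((∐ N).over ((fun V : X.affineOpens => (V : X.Opens)) V)).IsQuasicoherent := by
    intro V
    have hV : IsAffineOpen (V : X.Opens) := V.2
    obtain ⟨e⟩ := nonempty_restrict_sigmaObj_iso N hV.fromSpec
    haveI : (∐ fun i => (N i).restrict hV.fromSpec).IsQuasicoherent := isQuasicoherent_sigmaObj_Spec _
    haveI : IsIso (∐ fun i => (N i).restrict hV.fromSpec).fromTildeΓ :=
      (isQuasicoherent_iff_isIso_fromTildeΓ _).mp inferInstance
    let P₀ : ((∐ N).restrict hV.fromSpec).Presentation :=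
      Presentation.ofIsIso e.inv (Presentation.ofIsIso (∐ fun i => (N i).restrict hV.fromSpec).fromTildeΓ
        (presentationTilde.{u} _ .univ (by simp) _ (Submodule.span_eq _)))
    exact isQuasicoherent_over_of_presentation_restrict_fromSpec _ hV P₀
  exact IsQuasicoherent.of_coversTop (∐ N) (fun V : X.affineOpens => (V : X.Opens)) (coversTop_affineOpens'' X)

variable {N}

/-- **Stacks 01LA (1) for the tree's predicate**: `∐ Nᵢ` is affine-localizing for affine-localizing `Nᵢ` (no finite-support
hypothesis, unlike `Modules/AffineLocalizingBiproduct.IsAffineLocalizing.sigmaObj_of_finite_support`).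
[cite: StacksProject, Tag 01LA] [cite: Hartshorne1977, II Prop. 5.4] -/
theorem IsAffineLocalizing.sigmaObj (hN : ∀ i, IsAffineLocalizing (N i)) : IsAffineLocalizing (∐ N) := by
  haveI : ∀ i, (N i).IsQuasicoherent := fun i => isQuasicoherent_of_isAffineLocalizing (hN i)
  haveI := isQuasicoherent_sigmaObj N
  exact IsAffineLocalizing.of_isQuasicoherent _

end Literature.AlgebraicGeometry.Modules

end
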